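import Summits.HodgeConjecture.HodgeCM.Proofs.LandherrMatrix_1

/-! PORT of `HodgeCM/Proofs/LandherrMatrix.lean` (HodgeCMPerL run 82) — part 2: continuation of `Summits.HodgeConjecture.HodgeCM.Proofs.LandherrMatrix_1` (split at a top-level declaration boundary by port_pkg.py; scope re-opened below; declarations unchanged). -/

-- port_pkg: scope re-opened for this part (file-level context, then the namespace/section stack open at the cut)
set_option autoImplicit false
noncomputable section
open scoped Matrix
open Literature.AlgebraicGeometry.ShimuraVarieties (conjRingHomK embedding_conjRingHomK)
namespace HodgeCM
namespace LandherrRankN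
variable (L : CMField)
section Main
variable {ι : Type} [Fintype ι] [DecidableEq ι]
/-- Congruence of `H, H'` over `L` is isometry of any pair of diagonalisations. -/
theorem congr_iff_isomDiag {H H' G G' : Matrix ι ι L} {d d' : ι → L} (hG : IsUnit G.det)
    (e : cT L G * H * G = Matrix.diagonal d) (hG' : IsUnit G'.det) (e' : cT L G' * H' * G' = Matrix.diagonal d') :
    (∃ g : GL ι L, cT L (g : Matrix ι ι L) * H * (g : Matrix ι ι L) = H') ↔ IsomDiag L d d' := by
  constructor
  · rintro ⟨g, hg⟩
    refine ⟨G⁻¹ * (g : Matrix ι ι L) * G', ?_, ?_⟩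
    · rw [Matrix.det_mul, Matrix.det_mul]
      exact ((Matrix.isUnit_nonsing_inv_det G hG).mul (Matrix.isUnits_det_units g)).mul hG'
    · rw [← e', ← hg, eq_congr_inv_diagonal L hG e, cT_mul, cT_mul]
      simp only [Matrix.mul_assoc]
  · rintro ⟨M, hM, hMe⟩
    have hunit : IsUnit (G * M * G'⁻¹).det := by
      rw [Matrix.det_mul, Matrix.det_mul]
      exact (hG.mul hM).mul (Matrix.isUnit_nonsing_inv_det G' hG')
    refine ⟨Matrix.nonsingInvUnit (G * M * G'⁻¹) hunit, ?_⟩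
    show cT L (G * M * G'⁻¹) * H * (G * M * G'⁻¹) = H'
    rw [eq_congr_inv_diagonal L hG' e', ← hMe, eq_congr_inv_diagonal L hG e, cT_mul, cT_mul]
    have h1 : G⁻¹ * G = 1 := Matrix.nonsing_inv_mul G hG
    have h2 : cT L G * cT L G⁻¹ = 1 := by rw [← cT_mul, h1, cT_one]
    calc cT L G'⁻¹ * (cT L M * cT L G) * (cT L G⁻¹ * Matrix.diagonal d * G⁻¹) * (G * M * G'⁻¹)
        = cT L G'⁻¹ * (cT L M * ((cT L G * cT L G⁻¹) * Matrix.diagonal d * (G⁻¹ * G)) * M) * G'⁻¹ := by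
          simp only [Matrix.mul_assoc]
      _ = cT L G'⁻¹ * (cT L M * Matrix.diagonal d * M) * G'⁻¹ := by
          rw [h2, h1, Matrix.one_mul, Matrix.mul_one]

end Main

end LandherrRankN

/-! ## The theorem -/

open LandherrRankN in
/-- **Landherr's theorem for hermitian matrices of arbitrary rank over a CM field** [La36] (Shimura, Doc. Math. 13
(2008) Thm 2.2(i) p. 748).  Let `L` be a CM field with complex conjugation `σ` and `H, H'` two `σ`-hermitian
(`ᵗ(σH) = H`) matrices of the same finite size over `L` with `det H, det H' ≠ 0`.  Then `H' = ᵗ(σg) · H · g` for some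
`g ∈ GL(L)` if and only if
* at every complex embedding `τ` of `L` the hermitian complex matrices `τ(H)` and `τ(H')` have the same number of
  positive eigenvalues (the signatures `σ_v` at the real places `v` of `L₀`), and
* `det H = det H' · z σ(z)` for some `z ∈ L^×` (equality of the discriminants in `L₀^× / N_{L/L₀}(L^×)`). -/
theorem landherr_hermitian_iff (L : CMField) {ι : Type} [Fintype ι] [DecidableEq ι] (H H' : Matrix ι ι L)
    (hH : H.transpose.map (conjRingHomK L) = H) (hH' : H'.transpose.map (conjRingHomK L) = H')
    (h0 : H.det ≠ 0) (h0' : H'.det ≠ 0) :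
    (∃ g : GL ι L, ((g : Matrix ι ι L).transpose.map (conjRingHomK L)) * H * (g : Matrix ι ι L) = H') ↔
      ((∀ τ : L →+* ℂ,
          (Finset.univ.filter fun i => 0 < (isHermitian_map L hH τ).eigenvalues i).card =
            (Finset.univ.filter fun i => 0 < (isHermitian_map L hH' τ).eigenvalues i).card) ∧
        ∃ z : L, z ≠ 0 ∧ H.det = H'.det * (z * conjRingHomK L z)) := by
  obtain ⟨G, hG, d, hd, hd0, e⟩ := exists_congr_diagonal L H hH h0
  obtain ⟨G', hG', d', hd', hd'0, e'⟩ := exists_congr_diagonal L H' hH' h0'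
  refine (congr_iff_isomDiag L hG e hG' e').trans ?_
  have key : IsomDiag L d d' ↔
      ((∀ τ : L →+* ℂ, (Finset.univ.filter fun i => 0 < (τ (d i)).re).card =
          (Finset.univ.filter fun i => 0 < (τ (d' i)).re).card) ∧
        ∃ z : L, z ≠ 0 ∧ ∏ i, d i = (∏ i, d' i) * (z * conjRingHomK L z)) :=
    ⟨fun h => (landherr_diagonal_iff L d d' hd hd' hd0 hd'0).mp h.exists_gl,
     fun h => by
      obtain ⟨g, hg⟩ := (landherr_diagonal_iff L d d' hd hd' hd0 hd'0).mpr h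
      exact IsomDiag.of_gl g hg⟩
  refine key.trans (and_congr (forall_congr' fun τ => ?_) ?_)
  · rw [card_pos_eigenvalues_eq_posCount L hH hG e τ, card_pos_eigenvalues_eq_posCount L hH' hG' e' τ]
    rfl
  · rw [prod_eq_det_mul_norm L e, prod_eq_det_mul_norm L e']
    exact normClass_mul_norm_iff L hG.ne_zero hG'.ne_zero

/-- The rank-`n` matrix form over `Fin n`. -/
theorem landherr_hermitian_rank_iff (L : CMField) (n : ℕ) (H H' : Matrix (Fin n) (Fin n) L)
    (hH : H.transpose.map (conjRingHomK L) = H) (hH' : H'.transpose.map (conjRingHomK L) = H')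
    (h0 : H.det ≠ 0) (h0' : H'.det ≠ 0) :
    (∃ g : GL (Fin n) L, ((g : Matrix (Fin n) (Fin n) L).transpose.map (conjRingHomK L)) * H *
        (g : Matrix (Fin n) (Fin n) L) = H') ↔
      ((∀ τ : L →+* ℂ,
          (Finset.univ.filter fun i => 0 < (LandherrRankN.isHermitian_map L hH τ).eigenvalues i).card =
            (Finset.univ.filter fun i => 0 < (LandherrRankN.isHermitian_map L hH' τ).eigenvalues i).card) ∧
        ∃ z : L, z ≠ 0 ∧ H.det = H'.det * (z * conjRingHomK L z)) :=
  landherr_hermitian_iff L H H' hH hH' h0 h0'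

/-- **Diagonalisability**, root-level form: every non-degenerate `σ`-hermitian matrix over a CM field is
`ᵗ(σg) · H · g = diag d` for some `g ∈ GL(L)` and `d` with `σ`-fixed non-zero entries. -/
theorem hermitian_congr_diagonal (L : CMField) {ι : Type} [Fintype ι] [DecidableEq ι] (H : Matrix ι ι L)
    (hH : H.transpose.map (conjRingHomK L) = H) (h0 : H.det ≠ 0) :
    ∃ g : GL ι L, ∃ d : ι → L, (∀ i, conjRingHomK L (d i) = d i) ∧ (∀ i, d i ≠ 0) ∧
      ((g : Matrix ι ι L).transpose.map (conjRingHomK L)) * H * (g : Matrix ι ι L) = Matrix.diagonal d := by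
  obtain ⟨G, hG, d, hd, hd0, e⟩ := LandherrRankN.exists_congr_diagonal L H hH h0
  exact ⟨Matrix.nonsingInvUnit G hG, d, hd, hd0, e⟩

end HodgeCM

end
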